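import Summits.NavierStokesRegularity.NavierStokesRegularity.Theorems.TypeIIInviscidRelaxationAxisymSwirlRegularCoreReynoldsCriterion
import HarnessLib

/-!
# The core-Reynolds criterion with a free CORE SCALE: the rescaled profile `F_{p,m}(ξ/ε)`

Helper toward the crux `OneSidedRadialCriterion` (stmt-NavierStokesRegularity-19059; line `subcritical_core_reynolds`,
stub `stub_subcriticalCoreReynolds`: «under the gate `r u_r ≥ −Cν` the inflow Reynolds number becomes `< 2` in EVERY
parabolic core `r < ξ√(ν(T−t))` near `T`»), criterion side.

The tree's two-level criterion (`RadialInflowCoreReynolds.exists_coreWidth_twoLevelReynolds`: level `d₀ < 2` inside a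
parabolic core of width `ξ₀(d₀,Λ₀) ≥ 1`, any level `Λ₀` outside) comes from ONE explicit profile
`F_{p,m}(ξ) = ξ^p(1+ξ²)^{−(p/2−m)}` of the self-similar reduction
`RadialInflowSelfSimilar.hasSmoothExtensionPast_of_reynoldsProfile`.  Leray's similarity leaves `ξ = r/√(ν(T−t))`
invariant, so the core width cannot be moved by rescaling the SOLUTION — but the PROFILE can be rescaled: this file
runs the reduction with `F_{p,m,ε}(ξ) = F_{p,m}(ξ/ε)` for an arbitrary core scale `ε > 0` and computes its admissible
Reynolds profile in closed form,

  `D_{p,m,ε}(ξ) = (p(2−p) + 4p(1−m)s² + 4m(1−m)s⁴ + ε²(p/2−m)s²(1+s²)) / ((1+s²)(p+2ms²))`,  `s = ξ/ε`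

(`ε = 1` is the tree's `D_{p,m}`).  The `ε`-free part is the profile's own shape (`= 2−p` at the axis scale, a hump
rising towards `4(1−m)` for `1 ≪ s ≪ √(p/m)`); the term `ε²(p/2−m)s²/(p+2ms²) = (p/2−m)ξ²/(p+2mξ²/ε²)` is the
similarity-confinement gain (outward drift `ξ/2` against the sink), saturating at `ε²(p/2−m)/(2m)`.

* `scaledProfile_ode` — the profile equation holds with EQUALITY for `(F_{p,m,ε}, D_{p,m,ε})` (chain rule on the
  tree's `coreProfile_ode` data + a rational identity);
* `hasSmoothExtensionPast_of_scaledCoreReynolds` — the criterion: inflow Reynolds number `≤ D_{p,m,ε}(r/√(ν(T−t)))`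
  on the unit tube ⇒ continuation past `T` (`0 < p < 2`, `0 < m < p/2`, `2m ≤ 1`, `ε > 0`).

The consequences (core level `2−p` everywhere, the gain, the hump; a two-level criterion with an ARBITRARILY THIN
subcritical core for outer levels `< 4`) are in `…CoreReynoldsThinCore.lean`.  Honest label: a regularity CRITERION
(comparison method); the open half `C ≥ 2` of ⟨19059⟩ is untouched; nothing here proves `OneSidedRadialCriterion`,
`AxisymSwirlRegular` or NavierStokesRegularity.  References: Qi S. Zhang, arXiv:2604.07785 (2026) §3
[Zhang2026PartialTypeI]; tree `…CoreReynoldsCriterion`, `…SelfSimilarBarrier`. [new]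
-/

noncomputable section

set_option linter.dupNamespace false

open Set Filter Topology Real
open Literature.Analysis.FluidPDE

namespace Summit.NavierStokesRegularity.NavierStokesRegularity.Theorems.RadialInflowThinCore

open Summit.NavierStokesRegularity.NavierStokesRegularity.Theorems
open Summit.NavierStokesRegularity.NavierStokesRegularity.Theorems.ZhangBarrier
open Summit.NavierStokesRegularity.NavierStokesRegularity.Theorems.RadialInflowSelfSimilar
open Summit.NavierStokesRegularity.NavierStokesRegularity.Theorems.RadialInflowCoreReynolds

/-! ## §1 The rescaled profile `F_{p,m,ε}(ξ) = F_{p,m}(ξ/ε)` and its derivatives -/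

/-- `F_ε′(x) = F(x/ε) A(x/ε) ε⁻¹` on `(0,∞)` (chain rule on the tree's `hasDerivAt_coreProfile`). -/
theorem hasDerivAt_scaledProfile {p m ε : ℝ} (hε : 0 < ε) {x : ℝ} (hx : 0 < x) :
    HasDerivAt (fun y : ℝ => (y / ε) ^ p * (1 + (y / ε) ^ 2) ^ (-(p / 2 - m)))
      ((x / ε) ^ p * (1 + (x / ε) ^ 2) ^ (-(p / 2 - m)) *
        (p / (x / ε) - 2 * (p / 2 - m) * (x / ε) / (1 + (x / ε) ^ 2)) * ε⁻¹) x := by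
  have hs : 0 < x / ε := div_pos hx hε
  have hlin : HasDerivAt (fun y : ℝ => y / ε) ε⁻¹ x := by
    simpa [div_eq_mul_inv] using (hasDerivAt_id x).mul_const ε⁻¹
  exact (hasDerivAt_coreProfile (p := p) (m := m) hs).comp x hlin

/-- `(F_ε′)′(x) = F(x/ε) (A² + A′)(x/ε) ε⁻²` on `(0,∞)` (chain rule on the tree's `hasDerivAt_dcoreProfile`). -/
theorem hasDerivAt_dscaledProfile {p m ε : ℝ} (hε : 0 < ε) {x : ℝ} (hx : 0 < x) :
    HasDerivAt (fun y : ℝ => (y / ε) ^ p * (1 + (y / ε) ^ 2) ^ (-(p / 2 - m)) *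
        (p / (y / ε) - 2 * (p / 2 - m) * (y / ε) / (1 + (y / ε) ^ 2)) * ε⁻¹)
      ((x / ε) ^ p * (1 + (x / ε) ^ 2) ^ (-(p / 2 - m)) *
        ((p / (x / ε) - 2 * (p / 2 - m) * (x / ε) / (1 + (x / ε) ^ 2)) ^ 2
          + (-p / (x / ε) ^ 2 - 2 * (p / 2 - m) * (1 - (x / ε) ^ 2) / (1 + (x / ε) ^ 2) ^ 2)) * ε⁻¹ * ε⁻¹)
      x := by
  have hs : 0 < x / ε := div_pos hx hε
  have hlin : HasDerivAt (fun y : ℝ => y / ε) ε⁻¹ x := by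
    simpa [div_eq_mul_inv] using (hasDerivAt_id x).mul_const ε⁻¹
  exact ((hasDerivAt_dcoreProfile (p := p) (m := m) hs).comp x hlin).mul_const ε⁻¹

/-- `deriv F_ε` and `iteratedDeriv 2 F_ε` on `(0,∞)`. -/
theorem derivs_scaledProfile {p m ε : ℝ} (hε : 0 < ε) {x : ℝ} (hx : 0 < x) :
    deriv (fun y : ℝ => (y / ε) ^ p * (1 + (y / ε) ^ 2) ^ (-(p / 2 - m))) x
        = (x / ε) ^ p * (1 + (x / ε) ^ 2) ^ (-(p / 2 - m)) *
          (p / (x / ε) - 2 * (p / 2 - m) * (x / ε) / (1 + (x / ε) ^ 2)) * ε⁻¹ ∧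
      iteratedDeriv 2 (fun y : ℝ => (y / ε) ^ p * (1 + (y / ε) ^ 2) ^ (-(p / 2 - m))) x
        = (x / ε) ^ p * (1 + (x / ε) ^ 2) ^ (-(p / 2 - m)) *
          ((p / (x / ε) - 2 * (p / 2 - m) * (x / ε) / (1 + (x / ε) ^ 2)) ^ 2
            + (-p / (x / ε) ^ 2 - 2 * (p / 2 - m) * (1 - (x / ε) ^ 2) / (1 + (x / ε) ^ 2) ^ 2))
          * ε⁻¹ * ε⁻¹ := by
  refine ⟨(hasDerivAt_scaledProfile (p := p) (m := m) hε hx).deriv, ?_⟩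
  rw [show (2 : ℕ) = 1 + 1 from rfl, iteratedDeriv_succ, iteratedDeriv_one]
  have hev : deriv (fun y : ℝ => (y / ε) ^ p * (1 + (y / ε) ^ 2) ^ (-(p / 2 - m)))
      =ᶠ[𝓝 x] fun y => (y / ε) ^ p * (1 + (y / ε) ^ 2) ^ (-(p / 2 - m)) *
        (p / (y / ε) - 2 * (p / 2 - m) * (y / ε) / (1 + (y / ε) ^ 2)) * ε⁻¹ := by
    filter_upwards [Ioi_mem_nhds hx] with y hy using (hasDerivAt_scaledProfile (p := p) (m := m) hε hy).deriv
  rw [hev.deriv_eq]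
  exact (hasDerivAt_dscaledProfile (p := p) (m := m) hε hx).deriv

/-! ## §2 The profile equation with the Reynolds profile `D_{p,m,ε}` (EQUALITY) -/

/-- **The rescaled profile solves the profile equation with EQUALITY** for the Reynolds profile
`D_{p,m,ε}(ξ) = (p(2−p) + 4p(1−m)s² + 4m(1−m)s⁴ + ε²(p/2−m)s²(1+s²)) / ((1+s²)(p+2ms²))`, `s = ξ/ε`:
`F_ε″ + (D_{p,m,ε}(ξ)/ξ − 1/ξ − ξ/2)F_ε′ + mF_ε = 0` on `(0,∞)` (a rational identity; `ε = 1` is the tree's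
`coreProfile_ode`). [new] -/
theorem scaledProfile_ode {p m ε : ℝ} (hp : 0 < p) (hm : 0 ≤ m) (hε : 0 < ε) {ξ : ℝ} (hξ : 0 < ξ) :
    iteratedDeriv 2 (fun y : ℝ => (y / ε) ^ p * (1 + (y / ε) ^ 2) ^ (-(p / 2 - m))) ξ
      + ((p * (2 - p) + 4 * p * (1 - m) * (ξ / ε) ^ 2 + 4 * m * (1 - m) * (ξ / ε) ^ 4
            + ε ^ 2 * (p / 2 - m) * (ξ / ε) ^ 2 * (1 + (ξ / ε) ^ 2))
            / ((1 + (ξ / ε) ^ 2) * (p + 2 * m * (ξ / ε) ^ 2)) / ξ - ξ⁻¹ - ξ / 2)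
        * deriv (fun y : ℝ => (y / ε) ^ p * (1 + (y / ε) ^ 2) ^ (-(p / 2 - m))) ξ
      + m * ((ξ / ε) ^ p * (1 + (ξ / ε) ^ 2) ^ (-(p / 2 - m))) = 0 := by
  obtain ⟨h1, h2⟩ := derivs_scaledProfile (p := p) (m := m) hε hξ
  rw [h1, h2]
  obtain ⟨s, hs, hsx⟩ : ∃ s : ℝ, 0 < s ∧ ξ / ε = s := ⟨ξ / ε, div_pos hξ hε, rfl⟩
  have hξs : ξ = ε * s := by rw [← hsx]; field_simp
  rw [hsx, hξs]
  have hb : (1 + s ^ 2) ≠ 0 := by positivity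
  have hc : (p + 2 * m * s ^ 2) ≠ 0 := by positivity
  have hs0 : s ≠ 0 := hs.ne'
  have hε0 : ε ≠ 0 := hε.ne'
  set Fv := s ^ p * (1 + s ^ 2) ^ (-(p / 2 - m)) with hFv
  have key : ((p / s - 2 * (p / 2 - m) * s / (1 + s ^ 2)) ^ 2
            + (-p / s ^ 2 - 2 * (p / 2 - m) * (1 - s ^ 2) / (1 + s ^ 2) ^ 2)) * ε⁻¹ * ε⁻¹
      + ((p * (2 - p) + 4 * p * (1 - m) * s ^ 2 + 4 * m * (1 - m) * s ^ 4
            + ε ^ 2 * (p / 2 - m) * s ^ 2 * (1 + s ^ 2))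
            / ((1 + s ^ 2) * (p + 2 * m * s ^ 2)) / (ε * s) - (ε * s)⁻¹ - ε * s / 2)
        * ((p / s - 2 * (p / 2 - m) * s / (1 + s ^ 2)) * ε⁻¹) + m = 0 := by
    field_simp
    ring
  linear_combination Fv * key

/-! ## §3 Regularity, monotonicity and the squeeze bounds of the rescaled profile -/

/-- Smoothness of `F_ε` on `(0,∞)`. -/
theorem contDiffOn_scaledProfile (p m : ℝ) {ε : ℝ} (hε : 0 < ε) {n : WithTop ℕ∞} :
    ContDiffOn ℝ n (fun y : ℝ => (y / ε) ^ p * (1 + (y / ε) ^ 2) ^ (-(p / 2 - m))) (Ioi 0) := by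
  have h1 : ContDiffOn ℝ n (fun y : ℝ => y / ε) (Ioi 0) := (contDiff_id.div_const ε).contDiffOn
  refine (contDiffOn_coreProfile p m).comp h1 fun y hy => ?_
  exact div_pos hy hε

/-- Continuity of `F_ε` on `[0,∞)` (`p > 0`). -/
theorem continuousOn_scaledProfile {p m ε : ℝ} (hp : 0 < p) (hε : 0 < ε) :
    ContinuousOn (fun y : ℝ => (y / ε) ^ p * (1 + (y / ε) ^ 2) ^ (-(p / 2 - m))) (Ici 0) := by
  have h1 : ContinuousOn (fun y : ℝ => y / ε) (Ici 0) := (continuous_id.div_const ε).continuousOn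
  refine (continuousOn_coreProfile (m := m) hp).comp h1 fun y hy => ?_
  exact div_nonneg hy hε.le

/-- `F_ε(0) = 0` (`p > 0`). -/
theorem scaledProfile_zero {p m ε : ℝ} (hp : 0 < p) :
    ((0 : ℝ) / ε) ^ p * (1 + ((0 : ℝ) / ε) ^ 2) ^ (-(p / 2 - m)) = 0 := by
  rw [zero_div, coreProfile_zero hp]

/-- `F_ε` is nondecreasing on `[0,∞)`. -/
theorem monotoneOn_scaledProfile {p m ε : ℝ} (hp : 0 < p) (hm : 0 ≤ m) (hε : 0 < ε) :
    MonotoneOn (fun y : ℝ => (y / ε) ^ p * (1 + (y / ε) ^ 2) ^ (-(p / 2 - m))) (Ici 0) := by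
  intro a ha b hb hab
  exact monotoneOn_coreProfile (m := m) hp hm (div_nonneg ha hε.le) (div_nonneg hb hε.le)
    (div_le_div_of_nonneg_right hab hε.le)

/-- Upper bound `F_ε(ξ) ≤ ε^{−2m} ξ^{2m}` on `[0,∞)`. -/
theorem scaledProfile_le {p m ε : ℝ} (hp : 0 < p) (hm : 0 < m) (hmp : m < p / 2) (hε : 0 < ε) {ξ : ℝ}
    (hξ : 0 ≤ ξ) :
    (ξ / ε) ^ p * (1 + (ξ / ε) ^ 2) ^ (-(p / 2 - m)) ≤ (ε ^ (2 * m))⁻¹ * ξ ^ (2 * m) := by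
  have h := coreProfile_le hp hm hmp (div_nonneg hξ hε.le)
  rw [one_mul, Real.div_rpow hξ hε.le (2 * m)] at h
  rwa [inv_mul_eq_div]

/-- Far-field lower bound `F_ε(ξ) ≥ k₁ ξ^{2m}` for `ξ ≥ ρ₀ > 0`, `k₁ = (ρ′²/(1+ρ′²))^{p/2−m} ε^{−2m}`, `ρ′ = ρ₀/ε`. -/
theorem scaledProfile_ge_far {p m ε ρ₀ : ℝ} (hmp : m < p / 2) (hε : 0 < ε) (hρ₀ : 0 < ρ₀) {ξ : ℝ}
    (hξ : ρ₀ ≤ ξ) :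
    ((ρ₀ / ε) ^ 2 / (1 + (ρ₀ / ε) ^ 2)) ^ (p / 2 - m) * (ε ^ (2 * m))⁻¹ * ξ ^ (2 * m)
      ≤ (ξ / ε) ^ p * (1 + (ξ / ε) ^ 2) ^ (-(p / 2 - m)) := by
  have hξ0 : 0 ≤ ξ := hρ₀.le.trans hξ
  have h := coreProfile_ge_far (p := p) hmp (div_pos hρ₀ hε) (div_le_div_of_nonneg_right hξ hε.le)
  rw [Real.div_rpow hξ0 hε.le] at h
  calc ((ρ₀ / ε) ^ 2 / (1 + (ρ₀ / ε) ^ 2)) ^ (p / 2 - m) * (ε ^ (2 * m))⁻¹ * ξ ^ (2 * m)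
      = ((ρ₀ / ε) ^ 2 / (1 + (ρ₀ / ε) ^ 2)) ^ (p / 2 - m) * (ξ ^ (2 * m) / ε ^ (2 * m)) := by
        rw [div_eq_mul_inv (ξ ^ (2 * m))]; ring
    _ ≤ (ξ / ε) ^ p * (1 + (ξ / ε) ^ 2) ^ (-(p / 2 - m)) := h

/-- Near-field lower bound `F_ε(ξ) ≥ k₂ ξ²` on `[0, 2ρ₀]`, `k₂ = (2ρ′)^{p−2}(1+4ρ′²)^{−(p/2−m)} ε^{−2}`. -/
theorem scaledProfile_ge_near {p m ε ρ₀ : ℝ} (hp : 0 < p) (hp2 : p < 2) (hmp : m < p / 2) (hε : 0 < ε)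
    (hρ₀ : 0 < ρ₀) {ξ : ℝ} (h0 : 0 ≤ ξ) (h2 : ξ ≤ 2 * ρ₀) :
    (2 * (ρ₀ / ε)) ^ (p - 2) * (1 + 4 * (ρ₀ / ε) ^ 2) ^ (-(p / 2 - m)) * (ε ^ 2)⁻¹ * ξ ^ 2
      ≤ (ξ / ε) ^ p * (1 + (ξ / ε) ^ 2) ^ (-(p / 2 - m)) := by
  have h2' : ξ / ε ≤ 2 * (ρ₀ / ε) := by
    rw [mul_div_assoc']; exact div_le_div_of_nonneg_right h2 hε.le
  have h := coreProfile_ge_near (m := m) hp hp2 hmp (div_pos hρ₀ hε) (div_nonneg h0 hε.le) h2'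
  have e : (2 * (ρ₀ / ε)) ^ (p - 2) * (1 + 4 * (ρ₀ / ε) ^ 2) ^ (-(p / 2 - m)) * (ε ^ 2)⁻¹ * ξ ^ 2
      = (2 * (ρ₀ / ε)) ^ (p - 2) * (1 + 4 * (ρ₀ / ε) ^ 2) ^ (-(p / 2 - m)) * (ξ / ε) ^ 2 := by
    rw [div_pow ξ ε 2]; ring
  rw [e]
  exact h

/-! ## §4 The criterion with the rescaled profile -/

/-- **One-sided criterion with the Reynolds profile `D_{p,m,ε}`.** Let `0 < p < 2`, `0 < m < p/2`, `2m ≤ 1`,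
`ε > 0`, `ν, T > 0`, and let `(u, p)` be a classical solution on `[0,T)` at viscosity `ν`, Leray–Hopf from a rapidly
decaying datum, with axisymmetric slices.  If on the unit tube `0 < r ≤ 1` the inflow Reynolds number obeys
`−r u_r/ν ≤ D_{p,m,ε}(r/√(ν(T−t)))`,
`D_{p,m,ε}(ξ) = (p(2−p) + 4p(1−m)s² + 4m(1−m)s⁴ + ε²(p/2−m)s²(1+s²))/((1+s²)(p+2ms²))`, `s = ξ/ε`,
then `u` extends smoothly past `T`.  Proof: `RadialInflowSelfSimilar.hasSmoothExtensionPast_of_reynoldsProfile` with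
the exact profile `F_{p,m}(ξ/ε)` (`scaledProfile_ode`) and its squeeze bounds.  (`ε = 1` is the tree's
`hasSmoothExtensionPast_of_coreReynolds`; the core scale `ε` is a NEW free parameter — Leray's similarity fixes
`ξ = r/√(ν(T−t))`, so it cannot be produced by rescaling the solution.) [new] -/
theorem hasSmoothExtensionPast_of_scaledCoreReynolds {p₀ m ε ν T : ℝ}
    {u : ℝ → EuclideanSpace ℝ (Fin 3) → EuclideanSpace ℝ (Fin 3)} {p : ℝ → EuclideanSpace ℝ (Fin 3) → ℝ}
    (hp : 0 < p₀) (hp2 : p₀ < 2) (hm : 0 < m) (hmp : m < p₀ / 2) (h2m : 2 * m ≤ 1) (hε : 0 < ε)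
    (hν : 0 < ν) (hT : 0 < T)
    (hcl : IsClassicalNSSolutionOn (Ico 0 T) ν 0 u p) (hLH : IsLerayHopfOn T ν 0 (u 0) u)
    (hdec : HasRapidSpatialDecay (u 0)) (hax : ∀ t ∈ Ico 0 T, IsAxisymmetric (u t))
    (henv : ∀ t ∈ Ico 0 T, ∀ x : EuclideanSpace ℝ (Fin 3), 0 < cylRadius x → cylRadius x ≤ 1 →
      -(ν * ((p₀ * (2 - p₀) + 4 * p₀ * (1 - m) * (cylRadius x / √(ν * (T - t)) / ε) ^ 2
              + 4 * m * (1 - m) * (cylRadius x / √(ν * (T - t)) / ε) ^ 4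
              + ε ^ 2 * (p₀ / 2 - m) * (cylRadius x / √(ν * (T - t)) / ε) ^ 2
                * (1 + (cylRadius x / √(ν * (T - t)) / ε) ^ 2))
            / ((1 + (cylRadius x / √(ν * (T - t)) / ε) ^ 2)
              * (p₀ + 2 * m * (cylRadius x / √(ν * (T - t)) / ε) ^ 2)))
          / cylRadius x) ≤ radialVelocity (u t) x) :
    HasSmoothExtensionPast ν 0 u T := by
  have hρ₀ : 0 < rho (ν * T) 0 := rho_pos _ _
  have hk₁ : 0 < ((rho (ν * T) 0 / ε) ^ 2 / (1 + (rho (ν * T) 0 / ε) ^ 2)) ^ (p₀ / 2 - m)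
      * (ε ^ (2 * m))⁻¹ := by positivity
  have hk₂ : 0 < (2 * (rho (ν * T) 0 / ε)) ^ (p₀ - 2) * (1 + 4 * (rho (ν * T) 0 / ε) ^ 2) ^ (-(p₀ / 2 - m))
      * (ε ^ 2)⁻¹ := by positivity
  have hC₀ : 0 < (ε ^ (2 * m))⁻¹ := by positivity
  exact hasSmoothExtensionPast_of_reynoldsProfile
    (D := fun ξ => (p₀ * (2 - p₀) + 4 * p₀ * (1 - m) * (ξ / ε) ^ 2 + 4 * m * (1 - m) * (ξ / ε) ^ 4
        + ε ^ 2 * (p₀ / 2 - m) * (ξ / ε) ^ 2 * (1 + (ξ / ε) ^ 2))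
        / ((1 + (ξ / ε) ^ 2) * (p₀ + 2 * m * (ξ / ε) ^ 2)))
    (F := fun y : ℝ => (y / ε) ^ p₀ * (1 + (y / ε) ^ 2) ^ (-(p₀ / 2 - m)))
    hν hT hm h2m hC₀ hk₁ hk₂ (contDiffOn_scaledProfile p₀ m hε) (continuousOn_scaledProfile hp hε)
    (scaledProfile_zero hp) (monotoneOn_scaledProfile hp hm.le hε)
    (fun ξ hξ => scaledProfile_le hp hm hmp hε hξ)
    (fun ξ hξ => scaledProfile_ge_far hmp hε hρ₀ hξ)
    (fun ξ h0 h2 => scaledProfile_ge_near hp hp2 hmp hε hρ₀ h0 h2)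
    (fun ξ hξ => (scaledProfile_ode hp hm.le hε hξ).le) hcl hLH hdec hax henv

end Summit.NavierStokesRegularity.NavierStokesRegularity.Theorems.RadialInflowThinCore

end
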